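import Mathlib
import Summits.AtomisticToContinuum.HydrodynamicLimit.Theorems.InformationPercolationEngineKickFairRelEquilibriumMesoDefs
import Literature.Analysis.FluidPDE.HardSpherePhaseSpaceProofs
import HarnessLib

/-!
# KC — the key count of the line `Sketch` for the crux `KickFairRelEquilibriumMeso`
# (stmt-AtomisticToContinuum-15177; route `InformationPercolationEngine`)

Helper file (`--supports stmt-AtomisticToContinuum-15177`) landing the registered stub `stub_keyCount`
of the lead's skeleton (`Cruxes/KickFairRelEquilibriumMeso/Lines/Sketch.lean`) sorry-free, with the
registered signature verbatim: it is the predicate `KeyCount` of the line's vocabulary file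
`InformationPercolationEngineKickFairRelEquilibriumMesoDefs.lean`.

**Statement.** For every energy cap `K ≥ 0` there is `C` such that for every `N` the time-zero keys
`cellKey (rs N) (rs N) z` of all configurations `z` of `N + 1` spheres with `Σ_i ‖v_i‖² ≤ K (N+1)` lie
in a finite set of cardinality `≤ exp (C (N+1)^{3/4} log (N+2))` (sub-exponential in `N`: this is what
lets the glue pay every atypical level set of the key by `e^{-η(N+1)}`).

**Proof (elementary counting, crude bounds).**
* Cells: `Torus.coarseCell r x i = ⌊reprSym x i / r⌋` and `reprSym x i ∈ (-1/2, 1/2]`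
  (`Torus.reprSym_apply_mem_Ioc`), so every occupied cell `k` has `|k i| ≤ ⌈1/(2r)⌉₊`; outside this
  box the cell is empty and the key value is `(0, 0, 0)` (`cellKey_eq_of_forall_ne`). With
  `r = rs N = (N+1)^{-1/4}` the box has `(2⌈(N+1)^{1/4}/2⌉₊ + 1)³ ≤ 64 (N+1)^{3/4}` cells
  (`card_box_le`).
* Values: in a cell, the count is `≤ N+1`; each momentum coordinate is bounded by
  `Σ_{i∈I} ‖v_i‖ ≤ Σ_i (‖v_i‖² + 1) ≤ (K+1)(N+1)`; the cell energy is `≤ K(N+1)`; dividing by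
  `rs N` (`1/rs N = (N+1)^{1/4} ≤ N+1`) and taking integer parts, all binned values lie in
  `[-L, L]`, `L = (⌈K⌉₊+1)(N+1)²` (`triple_mem_vals`); the value set has `≤ (N+2)^{8(⌈K⌉₊+1)+13}`
  elements (`card_vals_le`, using `n < 2^n`).
* Functions `(Fin 3 → ℤ) → values` that map the box into the value set and are `(0,0,0)` off the box
  form a finite set of cardinality `≤ #values ^ #box` (`exists_finset_fun_card_le`: image of
  `Finset.pi`), whence `#keys ≤ (N+2)^{a · 64 (N+1)^{3/4}} = exp (64 a (N+1)^{3/4} log (N+2))`.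

Nothing here is specific to hard spheres beyond the vocabulary; no named fact is used. [folklore]
-/

noncomputable section

open Set

namespace Summit.AtomisticToContinuum.HydrodynamicLimit.Theorems.KickFairRelEquilibriumMesoLine

open Literature.Analysis.FluidPDE Literature.MathematicalPhysics.KineticTheory

/-- **Counting functions supported in a finite box.** For finite sets `B ⊆ α`, `V ⊆ β` and a default
value `d`, there is a finite set of functions `α → β` of cardinality `≤ #V ^ #B` containing every
function mapping `B` into `V` and equal to `d` off `B` (the image of `Finset.pi B (fun _ => V)` under
extension by `d`). [folklore] -/
theorem exists_finset_fun_card_le {α β : Type*} [DecidableEq α] (B : Finset α) (V : Finset β)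
    (d : β) :
    ∃ s : Finset (α → β), s.card ≤ V.card ^ B.card ∧
      ∀ f : α → β, (∀ a ∈ B, f a ∈ V) → (∀ a ∉ B, f a = d) → f ∈ s := by
  classical
  refine ⟨(B.pi fun _ => V).image fun g k => if h : k ∈ B then g k h else d, ?_, ?_⟩
  · calc ((B.pi fun _ => V).image fun g k => if h : k ∈ B then g k h else d).card
        ≤ (B.pi fun _ => V).card := Finset.card_image_le
      _ = V.card ^ B.card := by rw [Finset.card_pi, Finset.prod_const]
  · intro f hV hd
    rw [Finset.mem_image]
    refine ⟨fun k _ => f k, Finset.mem_pi.2 fun k hk => hV k hk, ?_⟩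
    funext k
    split_ifs with h
    · rfl
    · exact (hd k h).symm

/-- **Occupied cells lie in a box.** Every `r`-cell of the torus (`r > 0`) has all its integer
coordinates in `[-⌈1/(2r)⌉₊, ⌈1/(2r)⌉₊]`, because the symmetric representative has coordinates in
`(-1/2, 1/2]`. [folklore] -/
theorem coarseCell_mem_box {r : ℝ} (hr : 0 < r) (x : T3) :
    Torus.coarseCell r x ∈ Fintype.piFinset fun _ : Fin 3 =>
      Finset.Icc (-(⌈1 / (2 * r)⌉₊ : ℤ)) (⌈1 / (2 * r)⌉₊ : ℤ) := by
  rw [Fintype.mem_piFinset]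
  intro i
  have hmem := Torus.reprSym_apply_mem_Ioc x i
  have hc : (1 / (2 * r) : ℝ) ≤ (⌈1 / (2 * r)⌉₊ : ℝ) := Nat.le_ceil _
  have h12 : (1 / (2 * r) : ℝ) = (1 / 2 : ℝ) / r := by ring
  rw [Finset.mem_Icc]
  show -(⌈1 / (2 * r)⌉₊ : ℤ) ≤ ⌊Torus.reprSym x i / r⌋ ∧
    ⌊Torus.reprSym x i / r⌋ ≤ (⌈1 / (2 * r)⌉₊ : ℤ)
  constructor
  · rw [Int.le_floor]
    push_cast
    have h1 : (-(1 / 2 : ℝ)) / r ≤ Torus.reprSym x i / r :=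
      div_le_div_of_nonneg_right hmem.1.le hr.le
    rw [neg_div, ← h12] at h1
    linarith
  · rw [Int.floor_le_iff]
    push_cast
    have h1 : Torus.reprSym x i / r ≤ (1 / 2 : ℝ) / r := div_le_div_of_nonneg_right hmem.2 hr.le
    rw [← h12] at h1
    linarith

/-- **Empty cells carry the key value `(0, 0, 0)`.** If no particle of `z` lies in the cell `k`, then
`cellKey r w z k = (0, 0, 0)` (empty index set; `⌊0 / w⌋ = 0`). [folklore] -/
theorem cellKey_eq_of_forall_ne {N : ℕ} (r w : ℝ) (z : Phase N) {k : Fin 3 → ℤ}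
    (hk : ∀ i, Torus.coarseCell r (z i).1 ≠ k) :
    cellKey r w z k = (0, fun _ => 0, 0) := by
  simp [cellKey, hk]

/-- **The binned cell data of a bounded-energy configuration are bounded.** If
`Σ_i ‖v_i‖² ≤ K (N+1)` then for every index set `I` of particles: `#I ≤ N + 1`, and the integer parts of
the coordinates of `(Σ_{i∈I} v_i) / rs N` and of `(Σ_{i∈I} ‖v_i‖²) / rs N` lie in `[-L, L]` with
`L = (⌈K⌉₊ + 1)(N+1)²` (since `|Σ_{i∈I} v_i ⬝ e_j| ≤ Σ_i (‖v_i‖² + 1) ≤ (K+1)(N+1)` and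
`1 / rs N = (N+1)^{1/4} ≤ N + 1`). [folklore] -/
theorem triple_mem_vals {K : ℝ} (hK : 0 ≤ K) {N : ℕ} (z : Phase N)
    (hz : kinEnergy z ≤ K * ((N : ℝ) + 1)) (I : Finset (Fin (N + 1))) :
    (I.card, fun j => ⌊(∑ i ∈ I, (z i).2) j / rs N⌋, ⌊(∑ i ∈ I, ‖(z i).2‖ ^ 2) / rs N⌋) ∈
      Finset.range (N + 2) ×ˢ
        ((Fintype.piFinset fun _ : Fin 3 =>
            Finset.Icc (-(((⌈K⌉₊ + 1) * (N + 1) ^ 2 : ℕ) : ℤ))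
              (((⌈K⌉₊ + 1) * (N + 1) ^ 2 : ℕ) : ℤ)) ×ˢ
          Finset.Icc (-(((⌈K⌉₊ + 1) * (N + 1) ^ 2 : ℕ) : ℤ))
            (((⌈K⌉₊ + 1) * (N + 1) ^ 2 : ℕ) : ℤ)) := by
  set L : ℕ := (⌈K⌉₊ + 1) * (N + 1) ^ 2 with hL
  have hr := rs_pos N
  have hN0 : (0 : ℝ) < (N : ℝ) + 1 := by positivity
  have hN1 : (1 : ℝ) ≤ (N : ℝ) + 1 := by linarith [(Nat.cast_nonneg N : (0 : ℝ) ≤ N)]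
  -- `1 / rs N = (N+1)^{1/4} ≤ N + 1`
  have hinv_le : (rs N)⁻¹ ≤ (N : ℝ) + 1 := by
    rw [rs, Real.rpow_neg hN0.le, inv_inv]
    calc ((N : ℝ) + 1) ^ (1 / 4 : ℝ) ≤ ((N : ℝ) + 1) ^ (1 : ℝ) :=
          Real.rpow_le_rpow_of_exponent_le hN1 (by norm_num)
      _ = (N : ℝ) + 1 := Real.rpow_one _
  have hKc : K ≤ (⌈K⌉₊ : ℝ) := Nat.le_ceil K
  have hLreal : (K + 1) * ((N : ℝ) + 1) / rs N ≤ (L : ℝ) := by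
    rw [div_eq_mul_inv, hL]
    push_cast
    have h0 : 0 ≤ (K + 1) * ((N : ℝ) + 1) := by positivity
    calc (K + 1) * ((N : ℝ) + 1) * (rs N)⁻¹ ≤ (K + 1) * ((N : ℝ) + 1) * ((N : ℝ) + 1) :=
          mul_le_mul_of_nonneg_left hinv_le h0
      _ ≤ ((⌈K⌉₊ : ℝ) + 1) * ((N : ℝ) + 1) * ((N : ℝ) + 1) := by gcongr
      _ = ((⌈K⌉₊ : ℝ) + 1) * ((N : ℝ) + 1) ^ 2 := by ring
  -- the cell energy
  have hE0 : 0 ≤ ∑ i ∈ I, ‖(z i).2‖ ^ 2 := Finset.sum_nonneg fun i _ => by positivity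
  have hE : ∑ i ∈ I, ‖(z i).2‖ ^ 2 ≤ K * ((N : ℝ) + 1) :=
    (Finset.sum_le_univ_sum_of_nonneg fun i => by positivity).trans hz
  have hEL : K * ((N : ℝ) + 1) / rs N ≤ (L : ℝ) := by
    refine le_trans (div_le_div_of_nonneg_right ?_ hr.le) hLreal
    nlinarith
  -- the cell momentum, coordinatewise
  have hP : ∀ j, |(∑ i ∈ I, (z i).2) j| ≤ (K + 1) * ((N : ℝ) + 1) := by
    intro j
    calc |(∑ i ∈ I, (z i).2) j| = ‖(∑ i ∈ I, (z i).2) j‖ := (Real.norm_eq_abs _).symm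
      _ ≤ ‖∑ i ∈ I, (z i).2‖ := PiLp.norm_apply_le _ _
      _ ≤ ∑ i ∈ I, ‖(z i).2‖ := norm_sum_le _ _
      _ ≤ ∑ i ∈ I, (‖(z i).2‖ ^ 2 + 1) := Finset.sum_le_sum fun i _ => by
          nlinarith [sq_nonneg (‖(z i).2‖ - 1), norm_nonneg (z i).2]
      _ ≤ ∑ i, (‖(z i).2‖ ^ 2 + 1) := Finset.sum_le_univ_sum_of_nonneg fun i => by positivity
      _ = kinEnergy z + ((N : ℝ) + 1) := by
          rw [Finset.sum_add_distrib, Finset.sum_const, Finset.card_univ, Fintype.card_fin,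
            kinEnergy]
          simp
      _ ≤ (K + 1) * ((N : ℝ) + 1) := by linarith
  simp only [Finset.mem_product, Finset.mem_range, Fintype.mem_piFinset, Finset.mem_Icc]
  refine ⟨?_, fun j => ⟨?_, ?_⟩, ?_, ?_⟩
  · have h := I.card_le_univ
    rw [Fintype.card_fin] at h
    omega
  · rw [Int.le_floor]
    push_cast
    have h := (abs_le.1 (hP j)).1
    have h' : -((K + 1) * ((N : ℝ) + 1)) / rs N ≤ (∑ i ∈ I, (z i).2) j / rs N :=
      div_le_div_of_nonneg_right h hr.le
    rw [neg_div] at h'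
    linarith
  · rw [Int.floor_le_iff]
    push_cast
    have h := (abs_le.1 (hP j)).2
    have h' : (∑ i ∈ I, (z i).2) j / rs N ≤ (K + 1) * ((N : ℝ) + 1) / rs N :=
      div_le_div_of_nonneg_right h hr.le
    linarith
  · rw [Int.le_floor]
    push_cast
    have h' : 0 ≤ (∑ i ∈ I, ‖(z i).2‖ ^ 2) / rs N := div_nonneg hE0 hr.le
    have hL0 : (0 : ℝ) ≤ L := Nat.cast_nonneg _
    linarith
  · rw [Int.floor_le_iff]
    push_cast
    have h' : (∑ i ∈ I, ‖(z i).2‖ ^ 2) / rs N ≤ K * ((N : ℝ) + 1) / rs N :=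
      div_le_div_of_nonneg_right hE hr.le
    linarith

/-- **The box of cells is small:** at mesh `rs N = (N+1)^{-1/4}` the box
`[-⌈1/(2 rs N)⌉₊, ⌈1/(2 rs N)⌉₊]³` has at most `64 (N+1)^{3/4}` cells
(`2⌈q/2⌉₊ + 1 ≤ q + 3 ≤ 4q` for `q = (N+1)^{1/4} ≥ 1`). [folklore] -/
theorem card_box_le (N : ℕ) :
    ((Fintype.piFinset fun _ : Fin 3 =>
        Finset.Icc (-(⌈1 / (2 * rs N)⌉₊ : ℤ)) (⌈1 / (2 * rs N)⌉₊ : ℤ)).card : ℝ) ≤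
      64 * ((N : ℝ) + 1) ^ (3 / 4 : ℝ) := by
  rw [Fintype.card_piFinset_const, Int.card_Icc]
  have htn : ((⌈1 / (2 * rs N)⌉₊ : ℤ) + 1 - -(⌈1 / (2 * rs N)⌉₊ : ℤ)).toNat =
      2 * ⌈1 / (2 * rs N)⌉₊ + 1 := by
    omega
  rw [htn]
  push_cast
  set q : ℝ := ((N : ℝ) + 1) ^ (1 / 4 : ℝ) with hq
  have hN0 : (0 : ℝ) < (N : ℝ) + 1 := by positivity
  have hq1 : 1 ≤ q :=
    Real.one_le_rpow (by linarith [(Nat.cast_nonneg N : (0 : ℝ) ≤ N)]) (by norm_num)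
  have hr : rs N = q⁻¹ := by rw [hq, rs, Real.rpow_neg hN0.le]
  have hM : (⌈1 / (2 * rs N)⌉₊ : ℝ) < q / 2 + 1 := by
    have h0 : (0 : ℝ) ≤ 1 / (2 * rs N) :=
      div_nonneg zero_le_one (mul_nonneg zero_le_two (rs_pos N).le)
    have h := Nat.ceil_lt_add_one h0
    have h2 : 1 / (2 * rs N) = q / 2 := by
      rw [hr]
      have hq0 : q ≠ 0 := by positivity
      field_simp
    linarith [h2]
  have h34 : ((N : ℝ) + 1) ^ (3 / 4 : ℝ) = q ^ 3 := by
    rw [hq, ← Real.rpow_natCast, ← Real.rpow_mul hN0.le]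
    norm_num
  rw [h34]
  have h1 : 2 * (⌈1 / (2 * rs N)⌉₊ : ℝ) + 1 ≤ 4 * q := by linarith
  have h0' : (0 : ℝ) ≤ 2 * (⌈1 / (2 * rs N)⌉₊ : ℝ) + 1 := by positivity
  calc (2 * (⌈1 / (2 * rs N)⌉₊ : ℝ) + 1) ^ 3 ≤ (4 * q) ^ 3 := by gcongr
    _ = 64 * q ^ 3 := by ring

/-- **The value set is polynomial in `N`:** with `L = k₀ (N+1)²`, the set
`range (N+2) × [-L, L]³ × [-L, L]` has `(N+2)(2L+1)⁴ ≤ (N+2)^{8k₀+13}` elements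
(`2L + 1 ≤ (2k₀+1)(N+2)² ≤ (N+2)^{2k₀+3}` by `n < 2^n`). [folklore] -/
theorem card_vals_le (N k₀ : ℕ) :
    (Finset.range (N + 2) ×ˢ
        ((Fintype.piFinset fun _ : Fin 3 =>
            Finset.Icc (-((k₀ * (N + 1) ^ 2 : ℕ) : ℤ)) ((k₀ * (N + 1) ^ 2 : ℕ) : ℤ)) ×ˢ
          Finset.Icc (-((k₀ * (N + 1) ^ 2 : ℕ) : ℤ)) ((k₀ * (N + 1) ^ 2 : ℕ) : ℤ))).card ≤
      (N + 2) ^ (8 * k₀ + 13) := by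
  rw [Finset.card_product, Finset.card_product, Fintype.card_piFinset_const, Int.card_Icc,
    Finset.card_range]
  set L : ℕ := k₀ * (N + 1) ^ 2 with hL
  have htn : ((L : ℤ) + 1 - -(L : ℤ)).toNat = 2 * L + 1 := by omega
  rw [htn]
  have h1 : 2 * L + 1 ≤ (N + 2) ^ (2 * k₀ + 3) := by
    have h2 : 2 * k₀ + 1 ≤ (N + 2) ^ (2 * k₀ + 1) :=
      (2 * k₀ + 1).lt_two_pow_self.le.trans (Nat.pow_le_pow_left (by omega) _)
    calc 2 * L + 1 ≤ 2 * L + (N + 1) ^ 2 :=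
          Nat.add_le_add_left (Nat.one_le_pow 2 (N + 1) (Nat.succ_pos N)) _
      _ = (2 * k₀ + 1) * (N + 1) ^ 2 := by rw [hL]; ring
      _ ≤ (N + 2) ^ (2 * k₀ + 1) * (N + 2) ^ 2 :=
          Nat.mul_le_mul h2 (Nat.pow_le_pow_left (by omega) _)
      _ = (N + 2) ^ (2 * k₀ + 3) := by rw [← pow_add]
  calc (N + 2) * ((2 * L + 1) ^ 3 * (2 * L + 1))
      ≤ (N + 2) * (((N + 2) ^ (2 * k₀ + 3)) ^ 3 * (N + 2) ^ (2 * k₀ + 3)) := by gcongr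
    _ = (N + 2) ^ (8 * k₀ + 13) := by ring

/-- **The arithmetic of the count.** If `#s ≤ #V ^ #B`, `#V ≤ (N+2)^a` and `#B ≤ 64 (N+1)^{3/4}`,
then `#s ≤ exp (64 a (N+1)^{3/4} log (N+2))` (`x^n = exp (n log x)`). [folklore] -/
theorem card_le_exp_of {sc Vc Bc a N : ℕ} (hs : sc ≤ Vc ^ Bc) (hV : Vc ≤ (N + 2) ^ a)
    (hB : (Bc : ℝ) ≤ 64 * ((N : ℝ) + 1) ^ (3 / 4 : ℝ)) :
    (sc : ℝ) ≤ Real.exp (64 * (a : ℝ) * ((N : ℝ) + 1) ^ (3 / 4 : ℝ) * Real.log ((N : ℝ) + 2)) := by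
  have hsc : sc ≤ ((N + 2) ^ a) ^ Bc := hs.trans (Nat.pow_le_pow_left hV _)
  have hN2 : (0 : ℝ) < (N : ℝ) + 2 := by positivity
  have hlog : 0 ≤ Real.log ((N : ℝ) + 2) := Real.log_nonneg (by linarith)
  have h1 : (sc : ℝ) ≤ ((N : ℝ) + 2) ^ (a * Bc) := by
    rw [pow_mul]
    exact_mod_cast hsc
  have h2 : ((N : ℝ) + 2) ^ (a * Bc) = Real.exp (Real.log ((N : ℝ) + 2) * ((a * Bc : ℕ) : ℝ)) := by
    rw [← Real.rpow_def_of_pos hN2, Real.rpow_natCast]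
  rw [h2] at h1
  refine h1.trans ?_
  rw [Real.exp_le_exp]
  have h3 : ((a * Bc : ℕ) : ℝ) ≤ (a : ℝ) * (64 * ((N : ℝ) + 1) ^ (3 / 4 : ℝ)) := by
    push_cast
    exact mul_le_mul_of_nonneg_left hB (Nat.cast_nonneg _)
  calc Real.log ((N : ℝ) + 2) * ((a * Bc : ℕ) : ℝ)
      ≤ Real.log ((N : ℝ) + 2) * ((a : ℝ) * (64 * ((N : ℝ) + 1) ^ (3 / 4 : ℝ))) :=
        mul_le_mul_of_nonneg_left h3 hlog
    _ = 64 * (a : ℝ) * ((N : ℝ) + 1) ^ (3 / 4 : ℝ) * Real.log ((N : ℝ) + 2) := by ring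

/-- **KC — there are only `exp (O((N+1)^{3/4} log (N+2)))` keys of bounded energy** (registered stub
`stub_keyCount` of the line `Sketch`, = the predicate `KeyCount`). For every cap `K ≥ 0` there is `C`
(here `C = 64 (8(⌈K⌉₊+1) + 13)`) such that for every `N` the keys `cellKey (rs N) (rs N) z` of the
configurations `z` with `Σ_i ‖v_i‖² ≤ K (N+1)` lie in a finite set of cardinality
`≤ exp (C (N+1)^{3/4} log (N+2))`: box of cells × bounded binned values, counted by
`exists_finset_fun_card_le`, `card_box_le`, `card_vals_le`, `card_le_exp_of`, `triple_mem_vals`.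
[folklore] -/
theorem stub_keyCount : ∀ K : ℝ, 0 ≤ K → ∃ C : ℝ, ∀ N : ℕ, ∃ s : Finset ((Fin 3 → ℤ) → ℕ × (Fin 3 → ℤ) × ℤ), (s.card : ℝ) ≤ Real.exp (C * ((N : ℝ) + 1) ^ (3 / 4 : ℝ) * Real.log ((N : ℝ) + 2)) ∧ ∀ z : Phase N, kinEnergy z ≤ K * ((N : ℝ) + 1) → cellKey (rs N) (rs N) z ∈ s := by
  intro K hK
  refine ⟨64 * ((8 * (⌈K⌉₊ + 1) + 13 : ℕ) : ℝ), fun N => ?_⟩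
  obtain ⟨s, hcard, hmem⟩ := exists_finset_fun_card_le
    (Fintype.piFinset fun _ : Fin 3 =>
      Finset.Icc (-(⌈1 / (2 * rs N)⌉₊ : ℤ)) (⌈1 / (2 * rs N)⌉₊ : ℤ))
    (Finset.range (N + 2) ×ˢ
      ((Fintype.piFinset fun _ : Fin 3 =>
          Finset.Icc (-(((⌈K⌉₊ + 1) * (N + 1) ^ 2 : ℕ) : ℤ))
            (((⌈K⌉₊ + 1) * (N + 1) ^ 2 : ℕ) : ℤ)) ×ˢ
        Finset.Icc (-(((⌈K⌉₊ + 1) * (N + 1) ^ 2 : ℕ) : ℤ))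
          (((⌈K⌉₊ + 1) * (N + 1) ^ 2 : ℕ) : ℤ)))
    ((0 : ℕ), (fun _ : Fin 3 => (0 : ℤ)), (0 : ℤ))
  refine ⟨s, card_le_exp_of hcard (card_vals_le N (⌈K⌉₊ + 1)) (card_box_le N), ?_⟩
  intro z hz
  refine hmem _ (fun k _ => ?_) (fun k hk => ?_)
  · exact triple_mem_vals hK z hz _
  · refine cellKey_eq_of_forall_ne (rs N) (rs N) z fun i h => hk ?_
    rw [← h]
    exact coarseCell_mem_box (rs_pos N) (z i).1

end Summit.AtomisticToContinuum.HydrodynamicLimit.Theorems.KickFairRelEquilibriumMesoLine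

end
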